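import Summits.QuantumFields.YangMills.Theorems.UnitScaleTiltProp8FlatCubeOperators
import Summits.QuantumFields.YangMills.Theorems.UnitScaleTiltProp8FlatCubeLevels
import Summits.QuantumFields.YangMills.Theorems.UnitScaleTiltProp8FlatMinimizerH
import Literature.MathematicalPhysics.QuantumFieldTheory.Balaban1983to89.B5RowSumsP12Lattice
import HarnessLib

/-!
# Route `UnitScaleTilt`, crux K1 child «MinimiserStabilityRegPr» (stmt-QuantumFields-19200), v8 pillar **P2 `stub_flatOpsCubeSeq`** (OWNER RULING g20-№13
# AMENDMENT A; v8 pen ★ym-ust-19200-p2 g5 ASK (a) 11:56:30Z «the NAMES of your P2 letters … so that `def FlatOpsCubeSeq` is their conjunction verbatim»):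
# **THE P2 LETTER SCHEMAS, NAMED** — the hypothesis shapes of [Balaban1984PropagatorsII] Prop. 2.2 (2.47)–(2.51) / Cor. 2.8 (2.150)–(2.151) and
# [Balaban1985Variational] (46), (161)₁, (165) for the CANONICAL k-level flat operators `H = GQ*(QGQ*)⁻¹`, `G̃ = G − HQG` (`FlatCubeOperators`, p528409) of a
# nested family `D : B6SectADomainsV1.Domains (F.P K)` at the d = 3 carrier, in the F4 pen's level-weighted letter shapes (`FlatSmallSolution158CubeSeq`:
# `hG` of `existsUnique_smallSolution158_dom`, `hH` of `chart47_dom`; weights `(L^{j(x)}η)^m`, `j = levOf`, identified with [B6]'s territories by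
# `FlatCubeLevels.levOf_inOm_eq_iff` / `FlatCubeSequenceLevels.levOf_cubeSet_eq_iff_lamSite`)

Cell `ym3-torus` (HUMAN RULING D-0037, YM ladder rung R3), seat `ym3-torus-p1` gen 15.  `--supports stmt-QuantumFields-19200 --as helper`; count-neutral.
DEFINITIONS ONLY (Prop-valued schemas + two pieces of bookkeeping data); NOTHING is asserted; the v8 skeleton's `def FlatOpsCubeSeq` / `stub_flatOpsCubeSeq` is the
pen's to cut from these names (conjunction `FlatOpsAdmAt`; stub shape displayed in §4).  The CONTENT (proofs of the letters) is gap G-F3′-L0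
(UV3-NODE §24.3–24.6): [B6] §2 for nested families WITH a level-0 region, uniform in k — lit-balaban's hypothesis-free k-level layer covers `Ω₁ = T` only.

THE PRINT.  [Balaban1985Variational] (46) p. 285: *«|HB| ≦ B₀(Lʲη)⁻¹|B|, |∇HB| ≦ B₀(Lʲη)⁻²|B| on Ω_j»*; (161) p. 303: *«|HB|, |∇^ηHB|, |∂^{η*}∂^ηHB|, |Δ^ηHB| ≦
B₀Σ_{c∈ℭ_k} e^{−δ₀d(y₁,c₋)}(L^{j(c)}η)⁻¹|B(c)|»*; (162): *«It follows from the inequalities (2.47)–(2.51) of [3] that B₃ depends on d and L only»*; (163):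
*«We may assume that R₁M₁ is sufficiently big»*; (165) p. 304: *«|A|, |∇A|, |∂*∂A|, |ΔA| < … + B₀C₄(36dL²B₁Mε₀)² + …»* (the `G̃`-letters × Prop. 4); p. 302:
*«all the operators in this section are taken without any external gauge field configuration … [2,3]»*.  [Balaban1984PropagatorsII] p. 224 (2.1)–(2.2):
*«Ω_j^{(j)} … is a sum of big blocks, (Lʲη)⁻¹dist(Ω_jᶜ, Ω_{j+1}) > RM»*; Cor. 2.8 p. 249: *«|H(b,c)|, |(∇H)(b,c)| ≦ O(1)[1, (Lʲη)⁻¹](L^{j′}η)^{−d}e^{−δ₅d(y,c₋)}»*.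

NORMALISATION (displayed; print's): bond fields in η-units, unweighted values, difference quotients carry `η⁻¹ = L^{K−n}` (as in the F4 files); p21's lattice
factor `c := L^{K−n}` for `∂`, `∂*` (`dcE`, `dcsE`); auxiliary weights `a ≡ 1` (`H`, `G̃` are CANONICAL: `FlatCubeOperators.hOp_eq_hOp`/`Gt_eq_Gt`); constraint
data `X : 𝔅 → ℝ` in p21's normalisation (`QE`: `Q₀ = id`, `Q_j = bondAvgIter j`; print's `B(c) = (L^{j(c)}η)·X(c)`, `j(c) = c.1.1` the level of the index bond), so
(46) reads `(L^{j(b)}η)|HX(b)| ≤ B₀·sup_c (L^{j(c)}η)|X(c)|` (`HSupLetter`; the F4 pen's unweighted `hH` is this letter for `H ∘ diag((L^{j(c)}η)⁻¹)`) and (161)₁'s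
«(L^{j(c)}η)⁻¹|B(c)|» reads `|X(c)|` (`HDecayLetter`); `d(b, c)` := `distBI` = the level-`j(c)` sup circular distance of the `j(c)`-block of `b₋` to `c₋`, scaled
by `L^{j(c)−(K−n)}` to units; weights `w m b = (L^{j(b₋)}η)^m` with `j = levOf (i ↦ {x | D.InOm i x}) (K−n)`, passed with their defining equation
(`IsLevWeight`, instantiate by `rfl`) exactly as the F4 pen does.  ADMISSIBILITY `Adm22 D R M` = (2.1) positive levels unions of `M`-blocks + (2.2)
separation `> R·M` at every level; constants `B₀, δ₀` are fixed BEFORE `R ≥ R₀`, `M ≥ M₀` ((162)–(163)).  Instances: `FlatCubeSequence.cubeSeqT3` (P5's cube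
sequence; take `x₀`, `ρ`, `S` M-aligned for (2.1)) and `Domains.whole (K−n)` (the one-level/small-torus case of p1 g14's menu).

WHAT IS DEFINED (no theorem; nothing asserted): `Adm22`, `distBI`, `IsLevWeight`, `IsFlatH`, `IsFlatGt` (pinning to p528409's operators), the four letter schemas
`HSupLetter` (46), `HDecayLetter` (161)₁ ×4 (incl. VET L-H2's second-order letters for `H`), `GtSupLetter` (`hG` verbatim), `GtSecondLetter` ((165) ∂*∂, Δ),
the conjunction `FlatOpsAdmAt L R₀ M₀ B₀ δ₀` (the stub shape `∀ L > 1, ∃ R₀ M₀ B₀ δ₀ > 0, FlatOpsAdmAt L R₀ M₀ B₀ δ₀` is displayed in §4, not declared).  NOT included by design: the G3 junction (TRUE `Qlin = L^k·bondAvgIter − dΛ_k`,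
p522364 — C_k side, separate conjunct per AMENDMENT A), Hölder entries (not used by (165)).  NOT a claim about the mass gap.

References: T. Bałaban, CMP **102** (1985) 277–309 [Balaban1985Variational] (46) p.285, (144) p.300, (156)–(158) p.302, (161)–(163) p.303, (165) p.304;
CMP **96** (1984) 223–250 [Balaban1984PropagatorsII] (2.1)–(2.2) p.224, (2.35) p.228, Prop. 2.2 (2.47)–(2.51) p.231, Cor. 2.8 (2.150)–(2.151) p.249.
-/

set_option autoImplicit false

noncomputable section

open scoped BigOperators

namespace Summit.QuantumFields.YangMills.Theorems.FlatCubeOpsText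

open Literature.MathematicalPhysics.QuantumFieldTheory.Balaban1983to89
open Literature.MathematicalPhysics.QuantumFieldTheory.BalabanImbrieJaffe1984to88.BIJ85AxialPropagator411 (BondSpace)
open B6SectADomainsV1 (Domains)
open B6SectAOperatorsV1 (BondIdx BondIdxSpace QE QsE dcE dcsE)
open B6SectAVectorModelV1 (GE EE)
open B6SectA (hOp)
open B5Eq117TorusCarriers (Mk)
open B5Eq118OneStroke (iterBlockOf)
open B5Prop12FieldsLattice (distSite)
open B11Eq115Space (levOf)
open T3ContinuumYM3Torus (T3Family)

/-! ## §1 Geometry: admissibility (2.1)–(2.2) and the bond-to-index-bond distance of (161) -/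

/-- **(2.1)–(2.2) / [B8] (1.3)–(1.4) ADMISSIBILITY of a nested family at the Setup torus** with big-block size `M` and separation `R`: every positive-level
domain `Ω_j^{(j)}` is a union of `M`-blocks of `T^{(j)}` (labels `⌊y_μ/M⌋`), and `dist_j(Ω_{j+1}, Ω_jᶜ) > R·M` in the sup circular distance of `T^{(j)}`.
[cite: Balaban1984PropagatorsII, (2.1)-(2.2) p.224; Balaban1985RegularSpaces, (1.3)-(1.4) p.77] -/
def Adm22 {P : Params} (D : Domains P) (R M : ℕ) : Prop :=
  (∀ j, 1 ≤ j → ∀ y y' : Site P j, (∀ μ, (y μ).val / M = (y' μ).val / M) → (y ∈ D.Om j ↔ y' ∈ D.Om j)) ∧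
  (∀ j, ∀ y y' : Site P j, blockOf y ∈ D.Om (j + 1) → y' ∉ D.Om j → ((R * M : ℕ) : ℝ) < distSite (Mk P j) y y')

/-- **`d(y₁, c₋)` of (161)** for a fine bond `b ∈ Δ(y₁)` and an index bond `c ∈ Λ_{j(c)}`: the level-`j(c)` sup circular distance between the `j(c)`-block of
`b₋` and `c₋`, scaled by `L^{j(c)−k}` (units). [cite: Balaban1985Variational, (161) p.303] -/
def distBI {P : Params} (D : Domains P) (b : PBond P 0) (c : BondIdx D) : ℝ :=
  ((P.L : ℝ)⁻¹) ^ (D.k - (c.1.1 : ℕ)) * distSite (Mk P (c.1.1 : ℕ)) (iterBlockOf (c.1.1 : ℕ) b.src) c.1.2.src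

/-! ## §2 Pinning: the weights and the operators -/

section Carrier

variable (F : T3Family) (n K : ℕ) (D : Domains (F.P K))

/-- **THE LEVEL WEIGHTS** `w m b = (L^{j(b₋)}η)^m`, `η = L^{−(K−n)}`, `j = levOf (i ↦ {x | x ∈ Bⁱ(Ω_i^{(i)})}) (K−n)` (the F4 pen's convention; instantiate by `rfl`).
[cite: Balaban1985Variational, p.286, (152) p.301] -/
def IsLevWeight (w : ℕ → PBond (F.P K) 0 → ℝ) : Prop :=
  ∀ m b, w m b = ((F.L : ℝ) ^ levOf (fun j => {x : Site (F.P K) 0 | D.InOm j x}) (K - n) b.src * ((F.L : ℝ)⁻¹) ^ (K - n)) ^ m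

/-- **PINNING `H`**: the plain-function operator `H` IS print's `GQ*(QGQ*)⁻¹` of the family `D` (r03/p21's `hOp (GE D) (QsE D) (EE D)`, lattice factor `L^{K−n}`,
`a ≡ 1`; canonical by `FlatCubeOperators.hOp_eq_hOp`). [cite: Balaban1985Variational, (45) p.285, (157) p.302; Balaban1984PropagatorsII, (2.35) p.228] -/
def IsFlatH (H : (BondIdx D → ℝ) →ₗ[ℝ] (PBond (F.P K) 0 → ℝ)) : Prop :=
  ∀ (X : BondIdx D → ℝ) (b : PBond (F.P K) 0),
    H X b = hOp (GE D (c := (F.L : ℝ) ^ (K - n)) (pow_ne_zero _ (Nat.cast_ne_zero.2 (F.P K).L_pos.ne')) (w := fun _ => (1 : ℝ)) (fun _ => one_pos))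
      (QsE D) (EE D (c := (F.L : ℝ) ^ (K - n)) (pow_ne_zero _ (Nat.cast_ne_zero.2 (F.P K).L_pos.ne')) (w := fun _ => (1 : ℝ)) (fun _ => one_pos))
      (WithLp.toLp 2 X) b

/-- **PINNING `G̃`**: the plain-function operator `Gt` IS `G − HQG` of the family `D` (canonical by `FlatCubeOperators.Gt_eq_Gt`).
[cite: Balaban1985Variational, (143) p.300, (158) p.302] -/
def IsFlatGt (Gt : (PBond (F.P K) 0 → ℝ) →ₗ[ℝ] (PBond (F.P K) 0 → ℝ)) : Prop :=
  ∀ (f : PBond (F.P K) 0 → ℝ) (b : PBond (F.P K) 0),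
    Gt f b = (GE D (c := (F.L : ℝ) ^ (K - n)) (pow_ne_zero _ (Nat.cast_ne_zero.2 (F.P K).L_pos.ne')) (w := fun _ => (1 : ℝ)) (fun _ => one_pos)
      - hOp (GE D (c := (F.L : ℝ) ^ (K - n)) (pow_ne_zero _ (Nat.cast_ne_zero.2 (F.P K).L_pos.ne')) (w := fun _ => (1 : ℝ)) (fun _ => one_pos))
          (QsE D) (EE D (c := (F.L : ℝ) ^ (K - n)) (pow_ne_zero _ (Nat.cast_ne_zero.2 (F.P K).L_pos.ne')) (w := fun _ => (1 : ℝ)) (fun _ => one_pos))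
        ∘ₗ QE D ∘ₗ GE D (c := (F.L : ℝ) ^ (K - n)) (pow_ne_zero _ (Nat.cast_ne_zero.2 (F.P K).L_pos.ne')) (w := fun _ => (1 : ℝ)) (fun _ => one_pos))
      (WithLp.toLp 2 f) b

/-! ## §3 The four letter schemas -/

/-- **(H-i) = (46)**: `(L^{j(b)}η)|HX(b)| ≤ B₀·sup_c (L^{j(c)}η)|X(c)|` and the gradient `(L^{j(b)}η)²|∇^η(HX)(b)| ≤ B₀·sup_c (L^{j(c)}η)|X(c)|` — data weighted by the
level `c.1.1` of the index bond. [cite: Balaban1985Variational, (46) p.285] -/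
def HSupLetter (w : ℕ → PBond (F.P K) 0 → ℝ) (H : (BondIdx D → ℝ) →ₗ[ℝ] (PBond (F.P K) 0 → ℝ)) (B₀ : ℝ) : Prop :=
  ∀ (X : BondIdx D → ℝ) (t : ℝ), (∀ c, ((F.L : ℝ) ^ ((c.1.1 : ℕ)) * ((F.L : ℝ)⁻¹) ^ (K - n)) * |X c| ≤ t) →
    (∀ b, w 1 b * |H X b| ≤ B₀ * t) ∧
    ∀ (b : PBond (F.P K) 0) (ν : Fin 3), w 2 b * (F.L : ℝ) ^ (K - n) * |H X ⟨b.src.shift ν, b.dir⟩ - H X b| ≤ B₀ * t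

/-- **(H-ii) = (161)₁, THE FOUR DECAYING LETTERS** `|HB|, |∇^ηHB|, |∂^{η*}∂^ηHB|, |Δ^ηHB| ≤ B₀Σ_c e^{−δ₀d(b,c)}|X(c)|` (left sides level-weighted by `w 1`, `w 2`, `w 3`,
`w 3`; `∂*∂` = p21's `dcsE c (dcE c ·)`, `c = L^{K−n}`; `Δ` = the componentwise second-difference sum × `(L^{K−n})²`). [Balaban1984PropagatorsII] Cor. 2.8 gives the first
two with UNweighted left sides. [cite: Balaban1985Variational, (161) p.303; Balaban1984PropagatorsII, Cor. 2.8 (2.150)-(2.151) p.249] -/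
def HDecayLetter (w : ℕ → PBond (F.P K) 0 → ℝ) (H : (BondIdx D → ℝ) →ₗ[ℝ] (PBond (F.P K) 0 → ℝ)) (B₀ δ₀ : ℝ) : Prop :=
  ∀ (X : BondIdx D → ℝ) (b : PBond (F.P K) 0),
    w 1 b * |H X b| ≤ B₀ * ∑ c, Real.exp (-(δ₀ * distBI D b c)) * |X c| ∧
    (∀ ν : Fin 3, w 2 b * (F.L : ℝ) ^ (K - n) * |H X ⟨b.src.shift ν, b.dir⟩ - H X b| ≤ B₀ * ∑ c, Real.exp (-(δ₀ * distBI D b c)) * |X c|) ∧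
    w 3 b * |(dcsE ((F.L : ℝ) ^ (K - n)) (dcE ((F.L : ℝ) ^ (K - n)) (WithLp.toLp 2 (H X)))) b| ≤ B₀ * ∑ c, Real.exp (-(δ₀ * distBI D b c)) * |X c| ∧
    w 3 b * ((F.L : ℝ) ^ (K - n)) ^ 2 * |∑ ν : Fin 3, ((H X b - H X ⟨b.src.shift ν, b.dir⟩) + (H X b - H X ⟨b.src.unshift ν, b.dir⟩))| ≤
      B₀ * ∑ c, Real.exp (-(δ₀ * distBI D b c)) * |X c|

/-- **(G̃-i) = the `hG` shape of the F4 pen's `existsUnique_smallSolution158_dom` VERBATIM** («current size `f` ≤ β ⇒ size `G̃f` ≤ B₀β»: `w 3 → w 1`, `w 2·L^{K−n}` gradient).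
[cite: Balaban1985Variational, (158) p.302, (165) p.304; Balaban1984PropagatorsII, Prop. 2.2 (2.47)-(2.51) p.231] -/
def GtSupLetter (w : ℕ → PBond (F.P K) 0 → ℝ) (Gt : (PBond (F.P K) 0 → ℝ) →ₗ[ℝ] (PBond (F.P K) 0 → ℝ)) (B₀ : ℝ) : Prop :=
  ∀ (f : PBond (F.P K) 0 → ℝ) (β : ℝ), (∀ b, w 3 b * |f b| ≤ β) →
    (∀ b, w 1 b * |Gt f b| ≤ B₀ * β) ∧
    ∀ (b : PBond (F.P K) 0) (ν : Fin 3), w 2 b * (F.L : ℝ) ^ (K - n) * |Gt f ⟨b.src.shift ν, b.dir⟩ - Gt f b| ≤ B₀ * β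

/-- **(G̃-ii) = the second-order letters of (165)** («|∂^{η*}∂^ηA|, |Δ^ηA|» for `A₁ = −G̃W(…)`; C-B11-F1: at `U = 1` there is no Laplacian exclusion), weight `w 3`.
[cite: Balaban1985Variational, (165) p.304] -/
def GtSecondLetter (w : ℕ → PBond (F.P K) 0 → ℝ) (Gt : (PBond (F.P K) 0 → ℝ) →ₗ[ℝ] (PBond (F.P K) 0 → ℝ)) (B₀ : ℝ) : Prop :=
  ∀ (f : PBond (F.P K) 0 → ℝ) (β : ℝ), (∀ b, w 3 b * |f b| ≤ β) →
    ∀ (b : PBond (F.P K) 0),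
      w 3 b * |(dcsE ((F.L : ℝ) ^ (K - n)) (dcE ((F.L : ℝ) ^ (K - n)) (WithLp.toLp 2 (Gt f)))) b| ≤ B₀ * β ∧
      w 3 b * ((F.L : ℝ) ^ (K - n)) ^ 2 * |∑ ν : Fin 3, ((Gt f b - Gt f ⟨b.src.shift ν, b.dir⟩) + (Gt f b - Gt f ⟨b.src.unshift ν, b.dir⟩))| ≤ B₀ * β

end Carrier

/-! ## §4 The conjunction and the stub shape -/

/-- **THE P2 CONJUNCTION**: for every member (`F.L = L`), heights `n < K`, (2.2)-parameters `R ≥ R₀`, `M ≥ M₀`, EVERY nested family `D` with `D.k = K − n` and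
`Adm22 D R M`, its level weights and its canonical `H`, `G̃`: the four letters with the constants `B₀, δ₀` (fixed before `R, M`).
[cite: Balaban1985Variational, (46) p.285, (161)-(163) p.303, (165) p.304; Balaban1984PropagatorsII, Prop. 2.2 p.231, Cor. 2.8 p.249] -/
def FlatOpsAdmAt (L : ℕ) (R₀ M₀ : ℕ) (B₀ δ₀ : ℝ) : Prop :=
  ∀ (F : T3Family), F.L = L → ∀ (n K : ℕ), n < K → ∀ (R M : ℕ), R₀ ≤ R → M₀ ≤ M →
    ∀ (D : Domains (F.P K)), D.k = K - n → Adm22 D R M →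
    ∀ (w : ℕ → PBond (F.P K) 0 → ℝ), IsLevWeight F n K D w →
    ∀ (H : (BondIdx D → ℝ) →ₗ[ℝ] (PBond (F.P K) 0 → ℝ)) (Gt : (PBond (F.P K) 0 → ℝ) →ₗ[ℝ] (PBond (F.P K) 0 → ℝ)),
      IsFlatH F n K D H → IsFlatGt F n K D Gt →
      HSupLetter F n K D w H B₀ ∧ HDecayLetter F n K D w H B₀ δ₀ ∧ GtSupLetter F n K w Gt B₀ ∧ GtSecondLetter F n K w Gt B₀

/-! STUB SHAPE (for the v8 pen; deliberately NOT a declaration here — a parameterless cited `Prop` would be relocated to Literature by the gate):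
`theorem stub_flatOpsCubeSeq : ∀ (L : ℕ), 1 < L → ∃ (R₀ M₀ : ℕ) (B₀ δ₀ : ℝ), 0 < B₀ ∧ 0 < δ₀ ∧ FlatOpsAdmAt L R₀ M₀ B₀ δ₀`. -/

/-! ## §5 Guarded / power-of-`L` forms (OWNER RULING g21-№3 §A, T-P2-1 and T-P2-3) — THE FORMS THE v8 STUB USES

T-P2-3: the sup letters carry the harmless guards `0 ≤ t`, `0 ≤ β` (the weighted sups are nonnegative; with the guard the letter cannot be read on an empty index set
against a negative bound).  T-P2-1: the big-block size is a POWER OF `L`, `M = L^a` (the lineage's `cor28_kLevel_H` carries `M_h = L^a`; `Adm22 D R M` is not monotone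
in `M`; print fixes one pair `R₁, M₁`).  `FlatOpsAdmAt → FlatOpsAdmPowAt` (`flatOpsAdmPowAt_of_flatOpsAdmAt`): the guarded power form is WEAKER, costs the consumer nothing. -/

section Guarded

variable (F : T3Family) (n K : ℕ) (D : Domains (F.P K))

/-- **(H-i) = (46), GUARDED** (`0 ≤ t`; T-P2-3). [cite: Balaban1985Variational, (46) p.285] -/
def HSupLetterG (w : ℕ → PBond (F.P K) 0 → ℝ) (H : (BondIdx D → ℝ) →ₗ[ℝ] (PBond (F.P K) 0 → ℝ)) (B₀ : ℝ) : Prop :=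
  ∀ (X : BondIdx D → ℝ) (t : ℝ), 0 ≤ t → (∀ c, ((F.L : ℝ) ^ ((c.1.1 : ℕ)) * ((F.L : ℝ)⁻¹) ^ (K - n)) * |X c| ≤ t) →
    (∀ b, w 1 b * |H X b| ≤ B₀ * t) ∧
    ∀ (b : PBond (F.P K) 0) (ν : Fin 3), w 2 b * (F.L : ℝ) ^ (K - n) * |H X ⟨b.src.shift ν, b.dir⟩ - H X b| ≤ B₀ * t

/-- **(G̃-i), GUARDED** (`0 ≤ β`; T-P2-3) — the F4 pen's `hG` shape. [cite: Balaban1985Variational, (158) p.302, (165) p.304] -/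
def GtSupLetterG (w : ℕ → PBond (F.P K) 0 → ℝ) (Gt : (PBond (F.P K) 0 → ℝ) →ₗ[ℝ] (PBond (F.P K) 0 → ℝ)) (B₀ : ℝ) : Prop :=
  ∀ (f : PBond (F.P K) 0 → ℝ) (β : ℝ), 0 ≤ β → (∀ b, w 3 b * |f b| ≤ β) →
    (∀ b, w 1 b * |Gt f b| ≤ B₀ * β) ∧
    ∀ (b : PBond (F.P K) 0) (ν : Fin 3), w 2 b * (F.L : ℝ) ^ (K - n) * |Gt f ⟨b.src.shift ν, b.dir⟩ - Gt f b| ≤ B₀ * β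

/-- **(G̃-ii), GUARDED** (`0 ≤ β`; T-P2-3) — the second-order letters of (165). [cite: Balaban1985Variational, (165) p.304] -/
def GtSecondLetterG (w : ℕ → PBond (F.P K) 0 → ℝ) (Gt : (PBond (F.P K) 0 → ℝ) →ₗ[ℝ] (PBond (F.P K) 0 → ℝ)) (B₀ : ℝ) : Prop :=
  ∀ (f : PBond (F.P K) 0 → ℝ) (β : ℝ), 0 ≤ β → (∀ b, w 3 b * |f b| ≤ β) →
    ∀ (b : PBond (F.P K) 0),
      w 3 b * |(dcsE ((F.L : ℝ) ^ (K - n)) (dcE ((F.L : ℝ) ^ (K - n)) (WithLp.toLp 2 (Gt f)))) b| ≤ B₀ * β ∧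
      w 3 b * ((F.L : ℝ) ^ (K - n)) ^ 2 * |∑ ν : Fin 3, ((Gt f b - Gt f ⟨b.src.shift ν, b.dir⟩) + (Gt f b - Gt f ⟨b.src.unshift ν, b.dir⟩))| ≤ B₀ * β

variable {F n K D}

/-- the raw (H-i) implies the guarded form. [cite: Balaban1985Variational, (46) p.285] -/
theorem hSupLetterG_of_hSupLetter {w : ℕ → PBond (F.P K) 0 → ℝ} {H : (BondIdx D → ℝ) →ₗ[ℝ] (PBond (F.P K) 0 → ℝ)} {B₀ : ℝ}
    (h : HSupLetter F n K D w H B₀) : HSupLetterG F n K D w H B₀ :=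
  fun X t _ hX => h X t hX

/-- the raw (G̃-i) implies the guarded form. [cite: Balaban1985Variational, (165) p.304] -/
theorem gtSupLetterG_of_gtSupLetter {w : ℕ → PBond (F.P K) 0 → ℝ} {Gt : (PBond (F.P K) 0 → ℝ) →ₗ[ℝ] (PBond (F.P K) 0 → ℝ)} {B₀ : ℝ}
    (h : GtSupLetter F n K w Gt B₀) : GtSupLetterG F n K w Gt B₀ :=
  fun f β _ hf => h f β hf

/-- the raw (G̃-ii) implies the guarded form. [cite: Balaban1985Variational, (165) p.304] -/
theorem gtSecondLetterG_of_gtSecondLetter {w : ℕ → PBond (F.P K) 0 → ℝ} {Gt : (PBond (F.P K) 0 → ℝ) →ₗ[ℝ] (PBond (F.P K) 0 → ℝ)} {B₀ : ℝ}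
    (h : GtSecondLetter F n K w Gt B₀) : GtSecondLetterG F n K w Gt B₀ :=
  fun f β _ hf => h f β hf

end Guarded

/-- **THE P2 CONJUNCTION, POWER-OF-`L` BIG BLOCKS AND GUARDED LETTERS** (T-P2-1, T-P2-3) — the form the v8 stub `stub_flatOpsCubeSeq` names:
`∀ L > 1, ∃ R₀ M₀ B₀ δ₀ > 0, FlatOpsAdmPowAt L R₀ M₀ B₀ δ₀`. [cite: Balaban1984PropagatorsII, Prop. 2.6 (2.136) p.247, Prop. 2.7 (2.149)/Cor. 2.8 (2.150)–(2.151) p.249; Balaban1985Variational, (161)-(163) p.303] -/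
def FlatOpsAdmPowAt (L : ℕ) (R₀ M₀ : ℕ) (B₀ δ₀ : ℝ) : Prop :=
  ∀ (F : T3Family), F.L = L → ∀ (n K : ℕ), n < K → ∀ (R M : ℕ), R₀ ≤ R → M₀ ≤ M → (∃ a : ℕ, M = L ^ a) →
    ∀ (D : Domains (F.P K)), D.k = K - n → Adm22 D R M →
    ∀ (w : ℕ → PBond (F.P K) 0 → ℝ), IsLevWeight F n K D w →
    ∀ (H : (BondIdx D → ℝ) →ₗ[ℝ] (PBond (F.P K) 0 → ℝ)) (Gt : (PBond (F.P K) 0 → ℝ) →ₗ[ℝ] (PBond (F.P K) 0 → ℝ)),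
      IsFlatH F n K D H → IsFlatGt F n K D Gt →
      HSupLetterG F n K D w H B₀ ∧ HDecayLetter F n K D w H B₀ δ₀ ∧ GtSupLetterG F n K w Gt B₀ ∧ GtSecondLetterG F n K w Gt B₀

/-- the raw conjunction implies the power-of-`L`/guarded one (the v8 form is WEAKER). [cite: Balaban1984PropagatorsII, Prop. 2.6 (2.136) p.247, Prop. 2.7 (2.149)/Cor. 2.8 (2.150)–(2.151) p.249; Balaban1985Variational, (161)-(163) p.303] -/
theorem flatOpsAdmPowAt_of_flatOpsAdmAt {L R₀ M₀ : ℕ} {B₀ δ₀ : ℝ} (h : FlatOpsAdmAt L R₀ M₀ B₀ δ₀) : FlatOpsAdmPowAt L R₀ M₀ B₀ δ₀ := by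
  intro F hF n K hnK R M hR hM _ D hDk hAdm w hw H Gt hH hGt
  obtain ⟨h1, h2, h3, h4⟩ := h F hF n K hnK R M hR hM D hDk hAdm w hw H Gt hH hGt
  exact ⟨hSupLetterG_of_hSupLetter h1, h2, gtSupLetterG_of_gtSupLetter h3, gtSecondLetterG_of_gtSecondLetter h4⟩

/-! STUB SHAPE OF RECORD (v8, after OWNER RULING g21-№3 T-P2-1, T-P2-3; NOT declared — see §4):
`theorem stub_flatOpsCubeSeq : ∀ (L : ℕ), 1 < L → ∃ (R₀ M₀ : ℕ) (B₀ δ₀ : ℝ), 0 < B₀ ∧ 0 < δ₀ ∧ FlatCubeOpsText.FlatOpsAdmPowAt L R₀ M₀ B₀ δ₀`. -/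

/-! ## §6 THE MULTISCALE-METRIC FORM `FlatOpsAdmAtMS` = THE REGISTRABLE P2 TEXT (OWNER RULINGS g22-№1 §B (T-P2-3″, option (β), VET ITEM 10″) and g22-№3 §C (VET g2 finding V1, ITEM 12))

WHY.  (i) Print's (161)₁ decays in the MULTISCALE distance `d` of [Balaban1984PropagatorsII] (2.46) (every admissible step has `T_η`-length `≤ 1`), and (162)'s `B₃` is k-uniform only in
that metric (`B11B3.divergence_witness`: with the physical distance the row sum over the level-`j` index bonds diverges) — so the decay letter is stated over an ABSTRACT
`dBI : bond → index bond → ℝ` under `∃ dBI`, with §1's physical `distBI` kept as the COMPARATOR `distBI ≤ dBI` ((161) line 3 «|y₂ − y| ≤ d(y₁,y₂) + 3d²M_Δ» and the (163) tail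
convert through it) and with the (162) ROW SUM in the left-weighted shape (R2) (`B11B3.sum162_le`: print-true at every bond; a bare all-`b` row sum is unsatisfiable at a level-0 index bond
— RULING g22-№1 §B2); the RowSum rate `δ₀/2` is STRICTLY below the decay rate `δ₀` (the gap feeds the (163) remoteness factor).  (ii) VET g2 V1 (ACCEPTED, RULING g22-№3 §C1): the sup-data
`∂*∂G̃` row of `GtSecondLetter(G)` is FALSE for the canonical `G̃` uniformly in `K − n` (`∂*∂G̃ = 1 − Π_long − …`, the Helmholtz projection is unbounded on `ℓ^∞`; print p. 296 says so and takes
second order on the gauge slice of the critical configuration, (123)–(136)/(165)) ⇒ the registrable text conjoins the LAPLACIAN row ALONE (`GtLaplaceLetterG`; VET ITEM 12: no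
`ℓ^∞ → ℓ^∞` letter with two derivatives around `G`/`G̃` on sup data, second order only as Laplacian/Δ_a/H/Hölder rows).  The `H` rows all survive (`R∂*H = 0` exactly).
The landed `GtSecondLetter`/`GtSecondLetterG`/`FlatOpsAdmAt`/`FlatOpsAdmPowAt` stay as defs; NO registered text may conjoin the `∂*∂G̃` row. -/

section MS

variable (F : T3Family) (n K : ℕ) (D : Domains (F.P K))

/-- **(H-ii) = (161)₁ OVER AN ABSTRACT DISTANCE `dBI`** (the four rows of `HDecayLetter` with `distBI D b c ↦ dBI b c`; option (β) of RULING g22-№1 §B1).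
[cite: Balaban1985Variational, (161) p.303; Balaban1984PropagatorsII, Cor. 2.8 (2.150)-(2.151) p.249, (2.46) p.231] -/
def HDecayLetterD (dBI : PBond (F.P K) 0 → BondIdx D → ℝ) (w : ℕ → PBond (F.P K) 0 → ℝ) (H : (BondIdx D → ℝ) →ₗ[ℝ] (PBond (F.P K) 0 → ℝ)) (B₀ δ₀ : ℝ) : Prop :=
  ∀ (X : BondIdx D → ℝ) (b : PBond (F.P K) 0),
    w 1 b * |H X b| ≤ B₀ * ∑ c, Real.exp (-(δ₀ * dBI b c)) * |X c| ∧
    (∀ ν : Fin 3, w 2 b * (F.L : ℝ) ^ (K - n) * |H X ⟨b.src.shift ν, b.dir⟩ - H X b| ≤ B₀ * ∑ c, Real.exp (-(δ₀ * dBI b c)) * |X c|) ∧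
    w 3 b * |(dcsE ((F.L : ℝ) ^ (K - n)) (dcE ((F.L : ℝ) ^ (K - n)) (WithLp.toLp 2 (H X)))) b| ≤ B₀ * ∑ c, Real.exp (-(δ₀ * dBI b c)) * |X c| ∧
    w 3 b * ((F.L : ℝ) ^ (K - n)) ^ 2 * |∑ ν : Fin 3, ((H X b - H X ⟨b.src.shift ν, b.dir⟩) + (H X b - H X ⟨b.src.unshift ν, b.dir⟩))| ≤
      B₀ * ∑ c, Real.exp (-(δ₀ * dBI b c)) * |X c|

/-- **(162) AS A LEFT-WEIGHTED ROW SUM (shape (R2))**: `(L^{j(b)}η)·Σ_c e^{−½δ₀d(b,c)}(d(b,c) + 1)(L^{j(c)}η)⁻¹ ≤ B₃` at EVERY fine bond `b` (at `j(b) = K − n` this is (162) verbatim;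
`B11B3.sum162_le` makes it print-true, k- and b-uniform; a bare all-`b` row is unsatisfiable at level-0 index bonds). [cite: Balaban1985Variational, (162) p.303] -/
def RowSum162 (dBI : PBond (F.P K) 0 → BondIdx D → ℝ) (w : ℕ → PBond (F.P K) 0 → ℝ) (δ₀ B₃ : ℝ) : Prop :=
  ∀ b, w 1 b * ∑ c, Real.exp (-(δ₀ / 2 * dBI b c)) * (dBI b c + 1) * (F.L : ℝ) ^ ((K - n) - (c.1.1 : ℕ)) ≤ B₃

/-- **(G̃-ii), LAPLACIAN ROW ALONE, GUARDED** (= row 2 of `GtSecondLetterG`; VET g2 V1 / ITEM 12: the `∂*∂G̃` sup row is false and leaves the text). [cite: Balaban1985Variational, (165) p.304; Balaban1984PropagatorsII, Prop. 2.6 (2.136) p.247] -/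
def GtLaplaceLetterG (w : ℕ → PBond (F.P K) 0 → ℝ) (Gt : (PBond (F.P K) 0 → ℝ) →ₗ[ℝ] (PBond (F.P K) 0 → ℝ)) (B₀ : ℝ) : Prop :=
  ∀ (f : PBond (F.P K) 0 → ℝ) (β : ℝ), 0 ≤ β → (∀ b, w 3 b * |f b| ≤ β) →
    ∀ (b : PBond (F.P K) 0),
      w 3 b * ((F.L : ℝ) ^ (K - n)) ^ 2 * |∑ ν : Fin 3, ((Gt f b - Gt f ⟨b.src.shift ν, b.dir⟩) + (Gt f b - Gt f ⟨b.src.unshift ν, b.dir⟩))| ≤ B₀ * β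

variable {F n K D}

/-- the guarded second-order letter implies the Laplacian row. [cite: Balaban1985Variational, (165) p.304] -/
theorem gtLaplaceLetterG_of_gtSecondLetterG {w : ℕ → PBond (F.P K) 0 → ℝ} {Gt : (PBond (F.P K) 0 → ℝ) →ₗ[ℝ] (PBond (F.P K) 0 → ℝ)} {B₀ : ℝ}
    (h : GtSecondLetterG F n K w Gt B₀) : GtLaplaceLetterG F n K w Gt B₀ :=
  fun f β hβ hf b => (h f β hβ hf b).2

/-- the physical-distance decay letter is the `dBI := distBI` instance of the abstract one. [cite: Balaban1985Variational, (161) p.303] -/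
theorem hDecayLetterD_distBI_iff {w : ℕ → PBond (F.P K) 0 → ℝ} {H : (BondIdx D → ℝ) →ₗ[ℝ] (PBond (F.P K) 0 → ℝ)} {B₀ δ₀ : ℝ} :
    HDecayLetterD F n K D (fun b c => distBI D b c) w H B₀ δ₀ ↔ HDecayLetter F n K D w H B₀ δ₀ :=
  Iff.rfl

end MS

/-- **THE REGISTRABLE P2 TEXT — MULTISCALE-METRIC FORM** (RULING g22-№1 §B1 option (β) + g22-№3 §C3): for every member (`F.L = L`), heights `n < K`, `R ≥ R₀`, `M ≥ M₀` a POWER OF `L`,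
every nested family `D` with `D.k = K − n` and `Adm22 D R M`, and its level weights: THERE ARE the canonical operators `H`, `G̃` (pinned by `IsFlatH`/`IsFlatGt`) with the guarded (46)/`hG`
letters, the LAPLACIAN letter of (165), and a distance `dBI` DOMINATING the physical `distBI` under which the (162) row sum (rate `δ₀/2`, bound `B₃`) holds and the four (161)₁ rows decay at
rate `δ₀`.  Stub shape of record: `∀ L > 1, ∃ R₀ M₀ B₀ δ₀ B₃, 0 < B₀ ∧ 0 < δ₀ ∧ 0 < B₃ ∧ FlatOpsAdmAtMS L R₀ M₀ B₀ δ₀ B₃`.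
[cite: Balaban1985Variational, (46) p.285, (161)-(163) p.303, (165) p.304; Balaban1984PropagatorsII, (2.46) p.231, Prop. 2.6 (2.136) p.247, Prop. 2.7 (2.149)/Cor. 2.8 (2.150)–(2.151) p.249] -/
def FlatOpsAdmAtMS (L : ℕ) (R₀ M₀ : ℕ) (B₀ δ₀ B₃ : ℝ) : Prop :=
  ∀ (F : T3Family), F.L = L → ∀ (n K : ℕ), n < K → ∀ (R M : ℕ), R₀ ≤ R → M₀ ≤ M → (∃ a : ℕ, M = L ^ a) →
    ∀ (D : Domains (F.P K)), D.k = K - n → Adm22 D R M →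
    ∀ (w : ℕ → PBond (F.P K) 0 → ℝ), IsLevWeight F n K D w →
    ∃ (H : (BondIdx D → ℝ) →ₗ[ℝ] (PBond (F.P K) 0 → ℝ)) (Gt : (PBond (F.P K) 0 → ℝ) →ₗ[ℝ] (PBond (F.P K) 0 → ℝ)),
      IsFlatH F n K D H ∧ IsFlatGt F n K D Gt ∧
      HSupLetterG F n K D w H B₀ ∧ GtSupLetterG F n K w Gt B₀ ∧ GtLaplaceLetterG F n K w Gt B₀ ∧
      ∃ dBI : PBond (F.P K) 0 → BondIdx D → ℝ,
        (∀ b c, distBI D b c ≤ dBI b c) ∧ RowSum162 F n K D dBI w δ₀ B₃ ∧ HDecayLetterD F n K D dBI w H B₀ δ₀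

/-! STUB SHAPE OF RECORD (v8, after OWNER RULINGS g22-№1/№3; supersedes the §5 shape; NOT declared — see §4):
`theorem stub_flatOpsCubeSeq : ∀ (L : ℕ), 1 < L → ∃ (R₀ M₀ : ℕ) (B₀ δ₀ B₃ : ℝ), 0 < B₀ ∧ 0 < δ₀ ∧ 0 < B₃ ∧ FlatCubeOpsText.FlatOpsAdmAtMS L R₀ M₀ B₀ δ₀ B₃`. -/

end Summit.QuantumFields.YangMills.Theorems.FlatCubeOpsText

end
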